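import Literature.Probability.Process.LocalRubberMetric
import Mathlib.MeasureTheory.Constructions.BorelSpace.Basic
import HarnessLib

/-!
# Matching events, re-rooting and rooted hard-core configurations in the local rubber topology

Topic: `Literature/Probability/Process`. Sequel of `LocalRubberMetric.lean` (definition request
`defn-LocallyMatches`, part (2)): the classes of configurations singled out by the requesting
routes — rooted `δ`-hard-core configurations, `IsRootedHardCore δ` of `PointStationaryLaw.lean` —
inside the local rubber metric space `LocalConfig E`.

* `LocalConfig.eventually_locallyMatches_of_tendsto`, `LocalConfig.isOpen_setOf_locallyMatches` —
  OPEN FATTENINGS: a strict `(R', ε')`-matching with a fixed pattern survives along every sequence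
  converging in the local rubber topology at any `R < R'`, `ε > ε'`; the strict matching event of
  a pattern is open (the form in which matching events pass along local weak limits, portmanteau).
* `LocalConfig.translate S y = S - y` (RE-ROOTING at `y`): `mem_translate_iff`,
  `zero_mem_translate`, `translate_zero`, `translate_translate`, `separated_translate`,
  `LocallyMatches.translate`
  (matchings translate with radius loss `‖y‖`), `continuous_translate` (the translation action
  is continuous, Baake–Lenz §4), `toMeasure_translate` (on counting measures it is the shift
  `θ_y μ = μ.map (· - y)` of `IsPointStationaryLaw`).
* `LocalConfig.isClosed_setOf_separated`, `LocalConfig.isClosed_setOf_rooted_separated` — for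
  `δ > 0` the `δ`-separated configurations, and those that moreover contain the root `0`, form
  CLOSED sets of the local rubber topology (Baake–Lenz [BaakeLenz2004, §4 Prop. 4]: the class
  `𝒟_V` of `V`-discrete sets is closed, hence compact, in the LRT). Together with the compactness
  of `LocalConfig E` for proper `E` (Baake–Lenz Thm 3, Lenz–Stollmann Thm 1.2; not in this file)
  this is the compactness of the space of rooted hard-core configurations used for
  Benjamini–Schramm (local weak) limits of finite configurations seen from a typical point.
* `LocalConfig.instMeasurableSpace` / `instBorelSpace` — the Borel σ-algebra of the local rubber
  topology (laws of random rooted configurations are measures on it);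
* `LocalConfig.toMeasure S = count|S`, `atoms_toMeasure`, `toMeasure_injective`,
  `isRootedHardCore_toMeasure_iff` — the encoding of configurations as counting measures used by
  `IsRootedHardCore` / `IsPointStationaryLaw`; the rooted hard-core class is exactly the preimage
  of `IsRootedHardCore δ`.

## References
* M. Baake, D. Lenz, *Dynamical systems on translation bounded measures*, Ergodic Theory Dynam.
  Systems 24 (2004) 1867–1893, §4 Def. 3 (V-discrete sets `𝒟_V`), Prop. 4. [BaakeLenz2004]
-/

noncomputable section

open _root_.MeasureTheory Set Filter
open scoped _root_.Topology

namespace Literature.Probability.Process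

namespace LocalConfig

/-! ### Matching events -/

section Events

variable {E : Type*} [SeminormedAddCommGroup E] {R R' ε ε' : ℝ}

/-- **Open fattenings**: if `u → T` in the local rubber topology and the pattern `S₀` is
`(R', ε')`-matched with `T`, then for every smaller radius `R < R'` and larger tolerance `ε > ε'`,
eventually `S₀` is `(R, ε)`-matched with `u n` (compose with a fine matching of `T` and `u n`,
`LocallyMatches.trans`). This is the form in which matching events pass along local limits
(portmanteau). [folklore] -/
theorem eventually_locallyMatches_of_tendsto {ι : Type*} {u : ι → LocalConfig E} {l : Filter ι}
    {T : LocalConfig E} {S₀ : Set E} (hu : Tendsto u l (𝓝 T))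
    (h : LocallyMatches R' ε' S₀ (T : Set E)) (hR : R < R') (hε : ε' < ε) (hε' : 0 ≤ ε') :
    ∀ᶠ n in l, LocallyMatches R ε S₀ (u n : Set E) := by
  set θ := min (ε - ε') (R' - R) / 2 with hθ_def
  have hθ : 0 < θ := by
    rw [hθ_def]
    exact div_pos (lt_min (by linarith) (by linarith)) two_pos
  have hθε : θ ≤ (ε - ε') / 2 := by
    rw [hθ_def]
    exact div_le_div_of_nonneg_right (min_le_left _ _) two_pos.le
  have hθR : θ ≤ (R' - R) / 2 := by
    rw [hθ_def]
    exact div_le_div_of_nonneg_right (min_le_right _ _) two_pos.le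
  filter_upwards [(tendsto_iff_locallyMatches.1 hu) (R + ε') θ hθ] with n hn
  exact (h.trans hn hε' hθ.le (by linarith) le_rfl).mono le_rfl (by linarith)

/-- **The open matching event of a pattern**: the configurations that are STRICTLY better than
`(R, ε)`-matched with `S₀` (at some larger radius and smaller nonnegative tolerance) form an open
set of the local rubber topology. [folklore] -/
theorem isOpen_setOf_locallyMatches (S₀ : Set E) (R ε : ℝ) :
    IsOpen {T : LocalConfig E | ∃ R' ε', R < R' ∧ 0 ≤ ε' ∧ ε' < ε ∧
      LocallyMatches R' ε' S₀ (T : Set E)} := by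
  rw [isOpen_iff_mem_nhds]
  rintro T ⟨R', ε', hR, hε', hε, h⟩
  -- shrink strictly: radius `(R + R')/2`, tolerance `(ε' + ε)/2`
  have hev := eventually_locallyMatches_of_tendsto (u := id) (l := 𝓝 T) tendsto_id h
    (show (R + R') / 2 < R' by linarith) (show ε' < (ε' + ε) / 2 by linarith) hε'
  refine mem_of_superset hev fun U hU => ?_
  exact ⟨(R + R') / 2, (ε' + ε) / 2, by linarith, by linarith, by linarith, hU⟩

end Events

/-! ### Translation (re-rooting) -/

section Translate

variable {E : Type*} [SeminormedAddCommGroup E]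

/-- **Translation / re-rooting** of a configuration: `S.translate y = S - y = {z - y | z ∈ S}`, the
configuration seen from `y` (for `y ∈ S` the new root is `y - y = 0`). On counting measures this is
the shift `θ_y μ = μ.map (· - y)` of `IsPointStationaryLaw` (`toMeasure_translate`). [folklore] -/
def translate (S : LocalConfig E) (y : E) : LocalConfig E :=
  LocalConfig.mk ((fun z => z - y) '' (S : Set E))

/-- The carrier of `S.translate y` is the translated point set. [folklore] -/
@[simp] theorem coe_translate (S : LocalConfig E) (y : E) :
    ((S.translate y : LocalConfig E) : Set E) = (fun z => z - y) '' (S : Set E) := rfl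

/-- `z ∈ S - y ↔ z + y ∈ S`. [folklore] -/
theorem mem_translate_iff {S : LocalConfig E} {y z : E} : z ∈ S.translate y ↔ z + y ∈ S := by
  change z ∈ (fun w => w - y) '' (S : Set E) ↔ z + y ∈ S
  constructor
  · rintro ⟨x, hx, rfl⟩
    rwa [sub_add_cancel]
  · intro h
    exact ⟨z + y, h, add_sub_cancel_right z y⟩

/-- Re-rooting at a point of the configuration puts the root at the origin. [folklore] -/
theorem zero_mem_translate {S : LocalConfig E} {y : E} (hy : y ∈ S) : (0 : E) ∈ S.translate y := by
  rw [mem_translate_iff, zero_add]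
  exact hy

/-- Translating by `0` does nothing. [folklore] -/
@[simp] theorem translate_zero (S : LocalConfig E) : S.translate 0 = S := by
  ext z
  rw [mem_translate_iff, add_zero]

/-- Translations compose. [folklore] -/
theorem translate_translate (S : LocalConfig E) (y y' : E) :
    (S.translate y).translate y' = S.translate (y' + y) := by
  ext z
  simp only [mem_translate_iff, add_assoc]

/-- Translation preserves separation (translations are isometries). [folklore] -/
theorem separated_translate {δ : ℝ} {S : LocalConfig E}
    (h : ∀ x ∈ S, ∀ x' ∈ S, x ≠ x' → δ ≤ dist x x') (y : E) :
    ∀ x ∈ S.translate y, ∀ x' ∈ S.translate y, x ≠ x' → δ ≤ dist x x' := by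
  intro x hx x' hx' hne
  rw [mem_translate_iff] at hx hx'
  have := h (x + y) hx (x' + y) hx' fun hxx' => hne (add_right_cancel hxx')
  rwa [dist_add_right] at this

/-- **Matchings translate** (the radius shrinks by `‖y‖`: the ball about the new root of radius
`R - ‖y‖` lies in the old ball). [folklore] -/
theorem _root_.Literature.Probability.Process.LocallyMatches.translate {R ε : ℝ} {S T : Set E}
    (h : LocallyMatches R ε S T) (y : E) :
    LocallyMatches (R - ‖y‖) ε ((fun z => z - y) '' S) ((fun z => z - y) '' T) := by
  have hball : ∀ p : E, ‖p - y‖ ≤ R - ‖y‖ → ‖p‖ ≤ R := fun p hp => by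
    have := norm_add_le (p - y) y
    rw [sub_add_cancel] at this
    linarith
  refine ⟨?_, ?_⟩
  · rintro _ ⟨p, hp, rfl⟩ hpR
    obtain ⟨q, hq, hqp⟩ := h.1 p hp (hball p hpR)
    exact ⟨q - y, mem_image_of_mem _ hq, by rwa [dist_sub_right]⟩
  · rintro _ ⟨q, hq, rfl⟩ hqR
    obtain ⟨p, hp, hqp⟩ := h.2 q hq (hball q hqR)
    exact ⟨p - y, mem_image_of_mem _ hp, by rwa [dist_sub_right]⟩

/-- **Translation is continuous** in the local rubber topology (Baake–Lenz: the translation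
action on `𝒞` is continuous). [cite: BaakeLenz2004, §4 (Def. 4, Thm 3: set dynamical systems)] -/
theorem continuous_translate (y : E) : Continuous fun S : LocalConfig E => S.translate y := by
  refine continuous_iff_continuousAt.2 fun S => ?_
  rw [ContinuousAt, tendsto_iff_locallyMatches]
  intro R ε hε
  filter_upwards [(nhds_hasBasis_locallyMatches S).mem_of_mem (i := (R + ‖y‖, ε)) hε] with T hT
  have := hT.translate y
  rwa [add_sub_cancel_right] at this

end Translate

/-! ### Closed hard-core classes -/

section HardCore

variable {E : Type*} [NormedAddCommGroup E]

/-- **Separation is closed in the local rubber topology**: the `δ`-separated configurations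
(`x ≠ y ⇒ δ ≤ dist x y`) form a closed set. (Two points of the limit at distance `< δ` are
approximated within `η` by points of the approximants, which then coincide, forcing the two points
to be within `2η` for every `η`.) [cite: BaakeLenz2004, §4 Prop. 4] -/
theorem isClosed_setOf_separated (δ : ℝ) :
    IsClosed {S : LocalConfig E | ∀ x ∈ S, ∀ y ∈ S, x ≠ y → δ ≤ dist x y} := by
  refine IsSeqClosed.isClosed fun u S hu hS => ?_
  intro x hx y hy hxy
  by_contra hlt
  push Not at hlt
  have hxy0 : 0 < dist x y := dist_pos.2 hxy
  -- choose `η` with `2η < dist x y` and `dist x y + 2η < δ`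
  obtain ⟨η, hη, hη1, hη2⟩ : ∃ η : ℝ, 0 < η ∧ 2 * η < dist x y ∧ dist x y + 2 * η < δ :=
    ⟨min (dist x y) (δ - dist x y) / 4,
      by have := lt_min hxy0 (sub_pos.2 hlt); positivity,
      by have := min_le_left (dist x y) (δ - dist x y); linarith,
      by have := min_le_right (dist x y) (δ - dist x y); linarith⟩
  have hev := (tendsto_iff_locallyMatches.1 hS) (max ‖x‖ ‖y‖) η hη
  obtain ⟨n, hn⟩ := (hev.and (Eventually.of_forall hu)).exists
  obtain ⟨hmatch, hsep⟩ := hn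
  obtain ⟨x', hx', hxx'⟩ := hmatch.2 x hx (le_max_left _ _)
  obtain ⟨y', hy', hyy'⟩ := hmatch.2 y hy (le_max_right _ _)
  by_cases hx'y' : x' = y'
  · subst hx'y'
    have : dist x y ≤ 2 * η :=
      calc dist x y ≤ dist x x' + dist x' y := dist_triangle _ _ _
        _ ≤ η + η := add_le_add hxx' (by rw [dist_comm]; exact hyy')
        _ = 2 * η := by ring
    linarith
  · have hδ := hsep x' hx' y' hy' hx'y'
    have : dist x' y' ≤ dist x y + 2 * η :=
      calc dist x' y' ≤ dist x' x + dist x y' := dist_triangle _ _ _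
        _ ≤ dist x' x + (dist x y + dist y y') := add_le_add le_rfl (dist_triangle _ _ _)
        _ ≤ η + (dist x y + η) :=
          add_le_add (by rw [dist_comm]; exact hxx') (add_le_add le_rfl hyy')
        _ = dist x y + 2 * η := by ring
    linarith

/-- **Rooted hard-core configurations form a closed class**: for `δ > 0`, the configurations that
contain the root `0` and are `δ`-separated form a closed set of the local rubber topology
(`0 ∈ u n` gives points of the limit within every `η` of the root; by separation they are one
point, of norm `0`). This is the class `𝒟_V ∩ {0 ∈ ·}` of Baake–Lenz, closed (hence compact) in
the LRT. [cite: BaakeLenz2004, §4 Prop. 4] -/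
theorem isClosed_setOf_rooted_separated {δ : ℝ} (hδ : 0 < δ) :
    IsClosed {S : LocalConfig E | (0 : E) ∈ S ∧ ∀ x ∈ S, ∀ y ∈ S, x ≠ y → δ ≤ dist x y} := by
  have hsep := isClosed_setOf_separated (E := E) δ
  refine IsSeqClosed.isClosed fun u S hu hS => ?_
  have hSsep : ∀ x ∈ S, ∀ y ∈ S, x ≠ y → δ ≤ dist x y :=
    hsep.isSeqClosed (fun n => (hu n).2) hS
  refine ⟨?_, hSsep⟩
  -- points of `S` within `η` of the root, for every `η > 0`
  have hnear : ∀ η : ℝ, 0 < η → ∃ q ∈ S, ‖q‖ ≤ η := fun η hη => by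
    obtain ⟨n, hmatch, hn⟩ :=
      (((tendsto_iff_locallyMatches.1 hS) 0 η hη).and (Eventually.of_forall hu)).exists
    obtain ⟨q, hq, hq0⟩ := hmatch.1 0 hn.1 (by simp)
    exact ⟨q, hq, by rwa [dist_zero_right] at hq0⟩
  obtain ⟨q, hq, hqδ⟩ := hnear (δ / 3) (by positivity)
  -- `q` is the unique point of `S` in the ball of radius `δ/3`, hence `‖q‖ ≤ η` for all `η`
  have hq_small : ∀ η : ℝ, 0 < η → ‖q‖ ≤ η := fun η hη => by
    obtain ⟨q', hq', hq'η⟩ := hnear (min η (δ / 3)) (lt_min hη (by positivity))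
    by_cases hqq' : q = q'
    · rw [hqq']
      exact hq'η.trans (min_le_left _ _)
    · have h1 := hSsep q hq q' hq' hqq'
      have h2 : dist q q' ≤ ‖q‖ + ‖q'‖ := by
        rw [dist_eq_norm]
        exact norm_sub_le q q'
      have h3 : ‖q'‖ ≤ δ / 3 := hq'η.trans (min_le_right _ _)
      linarith
  have hq0 : q = 0 := by
    rw [← norm_eq_zero]
    exact le_antisymm (le_of_forall_pos_lt_add fun η hη => by
      have := hq_small (η / 2) (by positivity); linarith) (norm_nonneg q)
  rw [hq0] at hq
  exact hq

end HardCore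

/-! ### Configurations as counting measures -/

section Borel

variable {E : Type*} [SeminormedAddCommGroup E]

/-- The Borel σ-algebra of the local rubber topology on configurations. [folklore] -/
instance instMeasurableSpace : MeasurableSpace (LocalConfig E) := borel _

/-- `LocalConfig E` carries its Borel σ-algebra. [folklore] -/
instance instBorelSpace : BorelSpace (LocalConfig E) := ⟨rfl⟩

end Borel

section ToMeasure

variable {E : Type*} [MeasurableSpace E]

/-- The counting measure `count|S` of a configuration (the encoding of rooted configurations used
by `IsRootedHardCore` and `IsPointStationaryLaw`). [folklore] -/
def toMeasure (S : LocalConfig E) : Measure E :=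
  (Measure.count : Measure E).restrict (S : Set E)

/-- Unfolding `toMeasure`. [folklore] -/
theorem toMeasure_def (S : LocalConfig E) :
    S.toMeasure = (Measure.count : Measure E).restrict (S : Set E) := rfl

/-- The atoms of `count|S` are the points of `S`. [folklore] -/
@[simp] theorem atoms_toMeasure [MeasurableSingletonClass E] (S : LocalConfig E) :
    atoms S.toMeasure = (S : Set E) :=
  atoms_count_restrict _

/-- `toMeasure` is injective (measurable singletons). [folklore] -/
theorem toMeasure_injective [MeasurableSingletonClass E] :
    Function.Injective (toMeasure : LocalConfig E → Measure E) := fun S T h => by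
  have := congrArg atoms h
  rw [atoms_toMeasure, atoms_toMeasure] at this
  exact SetLike.coe_injective this

/-- **The rooted hard-core class is the preimage of `IsRootedHardCore`**: `count|S` is a rooted
`δ`-hard-core configuration iff `0 ∈ S` and `S` is `δ`-separated. [folklore] -/
theorem isRootedHardCore_toMeasure_iff [PseudoMetricSpace E] [Zero E] [MeasurableSingletonClass E]
    (δ : ℝ) (S : LocalConfig E) :
    IsRootedHardCore δ S.toMeasure ↔ (0 : E) ∈ S ∧ ∀ x ∈ S, ∀ y ∈ S, x ≠ y → δ ≤ dist x y := by
  rw [isRootedHardCore_iff_atoms, atoms_toMeasure]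
  simp only [toMeasure_def, SetLike.mem_coe, and_true]

end ToMeasure

section ToMeasureTranslate

variable {E : Type*} [SeminormedAddCommGroup E] [MeasurableSpace E] [MeasurableSingletonClass E]
  [MeasurableAdd E]

/-- **Re-rooting is the shift of `IsPointStationaryLaw`**: the counting measure of `S - y` is the
push-forward `θ_y (count|S) = (count|S).map (· - y)` (`map_sub_count_restrict`). [folklore] -/
theorem toMeasure_translate (S : LocalConfig E) (y : E) :
    (S.translate y).toMeasure = S.toMeasure.map (fun z => z - y) := by
  rw [toMeasure_def, toMeasure_def, map_sub_count_restrict, coe_translate]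

end ToMeasureTranslate

end LocalConfig

end Literature.Probability.Process
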